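import Mathlib
import Literature.AlgebraicGeometry.Resolution.CobordantGame
import Literature.AlgebraicGeometry.Resolution.FormalCoordinateChange
import Literature.AlgebraicGeometry.Resolution.FormalInverseFunction
import Literature.AlgebraicGeometry.Resolution.PowerSeriesRegularLocal
import Summits.ResolutionOfSingularities.ResolutionOfSingularities.Theorems.WeightedInvariantGlobalizeLocalDropCanonize
import Summits.ResolutionOfSingularities.ResolutionOfSingularities.Theorems.WeightedInvariantGlobalizeLocalDropCylinder

/-!
# The formal Morse lemma with parameters: splitting off a hyperbolic pair

Crux `LocalWeightedDrop` (stmt-ResolutionOfSingularities-8899, route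
ResolutionOfSingularities/WeightedInvariant), line `hasse-ridge-face-selection`, registered stub
`stub_hyperbolicSplit` of the skeleton `LocalWeightedDrop` (the second half of the formal Morse lemma
with parameters, over an ARBITRARY field `k`, any characteristic).  For a singular germ
`f ∈ k[[x₀, …, x_{n+1}]]` with no `x₀²` and no `x₁²` term, with `c := ∂²f/∂x₀∂x₁(0) ≠ 0`, and with no
monomial of degree exactly one in `(x₀, x₁)`, there is a legal formal coordinate change `θ` (zero
constant terms, invertible linear part) and a germ `H ∈ k[[x₁, …, x_n]]` with
`f ∘ θ = x₀ · x₁ + H(x₂, …, x_{n+1})` (`H` renamed into the slots `2, …, n + 1` along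
`Fin.addNatEmb 2 : m ↦ m + 2`).

Proof (Hensel's lemma replaces completing the square, so no assumption on the characteristic).
* DECOMPOSITION (`HyperbolicSplit.decompose`).  With `ι = Fin.addNatEmb 2` and
  `H := killCompl ι f` (the monomials of `f` in `x₂, …, x_{n+1}` alone), every monomial of
  `g := f − rename ι H` has positive degree in `(x₀, x₁)`, hence degree `≥ 2` by hypothesis; slicing
  `g` by the exponent of `x₀` (`≥ 2`, `= 1`, `= 0`) and peeling off variables (`X_pow_dvd_iff`,
  `X_dvd_iff`) gives `g = x₀² A + x₀ x₁ U + x₁² B` with `A(0) = coeff_{x₀²} f = 0`,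
  `B(0) = coeff_{x₁²} f = 0`, `U(0) = c ≠ 0`.
* HENSEL (`HyperbolicSplit.hensel_quadratic`).  `k[[x]]` is complete for its maximal ideal
  (`maximalIdeal_mvPowerSeries_eq_span` and Mathlib's adic completeness of power series rings), hence
  Henselian (`IsAdicComplete.henselianRing`); the monic `T² − U T + A B` has the simple root `T ≡ U`
  modulo the maximal ideal, so there is `u` with `u² − U u + A B = 0` and `u(0) = U(0) = c ≠ 0`.
* FACTORISATION.  With `λ := B u⁻¹`: `x₀² A + x₀ x₁ U + x₁² B = (x₀ + λ x₁) · (A x₀ + u x₁)`, so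
  `f = Ψ^*(x₀ x₁ + rename ι H)` for `Ψ = (x₀ + λ x₁, A x₀ + u x₁, x₂, …, x_{n+1})`, whose linear part
  is `diag(1, c, 1, …, 1)` (`λ(0) = A(0) = 0`).
* INVERSION.  `θ := Ψ⁻¹` (formal inverse function theorem `FormalCoordChange.exists_comp_inverse`);
  `θ^*(Ψ^* G) = G` (`subst_subst_of_comp_eq_X`) and `θ` is legal (`isUnit_det_linMat_of_comp_eq_X`).
-/

set_option linter.dupNamespace false -- mandated namespace of this single-conjunct summit

namespace Summit.ResolutionOfSingularities.ResolutionOfSingularities.Theorems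

open Literature.AlgebraicGeometry.Resolution

namespace HyperbolicSplit

variable {k : Type} [Field k]

/-! ### Linear coefficients of products -/

/-- A product of two series without constant terms has no linear terms (`𝔪 · 𝔪 ⊆ 𝔪²`). -/
theorem coeff_single_mul_eq_zero {σ : Type*} {φ ψ : MvPowerSeries σ k}
    (hφ : MvPowerSeries.constantCoeff φ = 0) (hψ : MvPowerSeries.constantCoeff ψ = 0) (j : σ) :
    MvPowerSeries.coeff (Finsupp.single j 1) (φ * ψ) = 0 := by
  have h2 : (2 : ℕ∞) ≤ (φ * ψ).order := by
    have h1 : (1 : ℕ∞) ≤ φ.order := MvPowerSeries.one_le_order_iff_constCoeff_eq_zero.mpr hφ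
    have h1' : (1 : ℕ∞) ≤ ψ.order := MvPowerSeries.one_le_order_iff_constCoeff_eq_zero.mpr hψ
    calc (2 : ℕ∞) = 1 + 1 := by norm_num
      _ ≤ φ.order + ψ.order := add_le_add h1 h1'
      _ ≤ _ := MvPowerSeries.le_order_mul
  exact ((FormalCoordChange.two_le_order_iff _).mp h2).2 j

/-- The linear coefficients of `φ · x_s`: only `x_s` occurs, with coefficient `φ(0)`. -/
theorem coeff_single_mul_X {σ : Type*} [DecidableEq σ] (φ : MvPowerSeries σ k) (s j : σ) :
    MvPowerSeries.coeff (Finsupp.single j 1) (φ * MvPowerSeries.X s) =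
      if j = s then MvPowerSeries.constantCoeff φ else 0 := by
  have hsplit : φ * MvPowerSeries.X s = MvPowerSeries.C (MvPowerSeries.constantCoeff φ) * MvPowerSeries.X s +
      (φ - MvPowerSeries.C (MvPowerSeries.constantCoeff φ)) * MvPowerSeries.X s := by ring
  rw [hsplit, map_add, MvPowerSeries.coeff_C_mul, MvPowerSeries.coeff_index_single_X,
    coeff_single_mul_eq_zero (by simp) (MvPowerSeries.constantCoeff_X s), add_zero, mul_ite, mul_one, mul_zero]

/-! ### Hensel's lemma for `T² − U T + P` in `k[[x]]` -/

/-- Membership in the maximal ideal of `k[[x]]` is vanishing of the constant term. -/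
theorem mem_maximalIdeal_iff {σ : Type*} (φ : MvPowerSeries σ k) :
    φ ∈ IsLocalRing.maximalIdeal (MvPowerSeries σ k) ↔ MvPowerSeries.constantCoeff φ = 0 := by
  rw [IsLocalRing.mem_maximalIdeal, mem_nonunits_iff, MvPowerSeries.isUnit_iff_constantCoeff, isUnit_iff_ne_zero,
    not_not]

/-- HENSEL for the monic quadratic `T² − U·T + P` over `k[[x₁, …, x_m]]` with `U` a unit and `P(0) = 0`:
the simple root `T ≡ U (mod 𝔪)` lifts to a root `u` with `u(0) = U(0)` (`k[[x]]` is `𝔪`-adically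
complete, hence Henselian). -/
theorem hensel_quadratic {m : ℕ} (U P : MvPowerSeries (Fin m) k) (hU : MvPowerSeries.constantCoeff U ≠ 0)
    (hP : MvPowerSeries.constantCoeff P = 0) :
    ∃ u : MvPowerSeries (Fin m) k, u ^ 2 - U * u + P = 0 ∧
      MvPowerSeries.constantCoeff u = MvPowerSeries.constantCoeff U := by
  haveI : IsAdicComplete (IsLocalRing.maximalIdeal (MvPowerSeries (Fin m) k)) (MvPowerSeries (Fin m) k) := by
    rw [maximalIdeal_mvPowerSeries_eq_span k (Fin m)]
    infer_instance
  set F : Polynomial (MvPowerSeries (Fin m) k) :=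
    Polynomial.X ^ 2 + (Polynomial.C (-U) * Polynomial.X + Polynomial.C P) with hF
  have hmonic : F.Monic := Polynomial.monic_X_pow_add Polynomial.degree_linear_lt
  have heval : ∀ a, F.eval a = a ^ 2 - U * a + P := by
    intro a
    simp [F]
    ring
  have hder : F.derivative.eval U = U := by
    simp [F]
    ring
  have h1 : F.eval U ∈ IsLocalRing.maximalIdeal _ := by
    rw [mem_maximalIdeal_iff, heval]
    simp [hP, sq]
  have h2 : IsUnit (Ideal.Quotient.mk (IsLocalRing.maximalIdeal _) (F.derivative.eval U)) := by
    rw [hder]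
    refine IsUnit.map _ ?_
    rw [MvPowerSeries.isUnit_iff_constantCoeff, isUnit_iff_ne_zero]
    exact hU
  obtain ⟨u, hroot, hu⟩ := HenselianRing.is_henselian (I := IsLocalRing.maximalIdeal _) F hmonic U h1 h2
  refine ⟨u, ?_, ?_⟩
  · rw [← heval]
    exact hroot
  · rw [mem_maximalIdeal_iff, map_sub, sub_eq_zero] at hu
    exact hu

/-! ### The part of `f` in the variables `x₂, …, x_{n+1}` -/

/-- The range of `Fin.addNatEmb 2 : Fin n ↪ Fin (n + 2)` is `{i | 2 ≤ i}`. -/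
theorem mem_range_addNatEmb_iff {n : ℕ} (i : Fin (n + 2)) :
    i ∈ Set.range (Fin.addNatEmb (n := n) 2) ↔ 2 ≤ (i : ℕ) := by
  constructor
  · rintro ⟨m, rfl⟩
    simp
  · intro h
    exact ⟨Fin.subNat 2 i h, by ext; simp⟩

/-- An exponent is supported in the slots `2, …, n + 1` iff its `x₀`- and `x₁`-exponents vanish. -/
theorem support_subset_range_iff {n : ℕ} (d : Fin (n + 2) →₀ ℕ) :
    (↑d.support : Set (Fin (n + 2))) ⊆ Set.range (Fin.addNatEmb (n := n) 2) ↔ d 0 = 0 ∧ d 1 = 0 := by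
  constructor
  · intro h
    constructor
    · by_contra h0
      have := (mem_range_addNatEmb_iff 0).mp (h (by simpa using h0))
      simp at this
    · by_contra h1
      have := (mem_range_addNatEmb_iff 1).mp (h (by simpa using h1))
      simp at this
  · rintro ⟨h0, h1⟩ i hi
    rw [Finset.mem_coe, Finsupp.mem_support_iff] at hi
    rw [mem_range_addNatEmb_iff]
    by_contra hlt
    have hv : (i : ℕ) = 0 ∨ (i : ℕ) = 1 := by omega
    rcases hv with hv | hv
    · exact hi (by rwa [show i = 0 from Fin.ext hv])
    · exact hi (by rwa [show i = 1 from Fin.ext (by rw [hv, Fin.val_one])])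

/-- The coefficients of `rename ι (killCompl ι f)` (`ι = Fin.addNatEmb 2`): those of `f` on the
exponents not involving `x₀, x₁`, and `0` elsewhere. -/
theorem coeff_rename_killCompl {n : ℕ} (f : MvPowerSeries (Fin (n + 2)) k) (d : Fin (n + 2) →₀ ℕ) :
    MvPowerSeries.coeff d (MvPowerSeries.rename (Fin.addNatEmb (n := n) 2)
      (MvPowerSeries.killCompl (Fin.addNatEmb (n := n) 2) f)) =
      if d 0 = 0 ∧ d 1 = 0 then MvPowerSeries.coeff d f else 0 := by
  split_ifs with h
  · obtain ⟨x, rfl⟩ := (Finsupp.mem_range_embDomain_iff _ d).mpr ((support_subset_range_iff d).mpr h)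
    rw [MvPowerSeries.coeff_embDomain_rename, MvPowerSeries.coeff_killCompl]
  · apply MvPowerSeries.coeff_rename_eq_zero
    rintro ⟨x, rfl⟩
    apply h
    rw [← support_subset_range_iff, ← Finsupp.embDomain_eq_mapDomain]
    exact (Finsupp.mem_range_embDomain_iff _ _).mp ⟨x, rfl⟩

/-! ### The decomposition `g = x₀² A + x₀ x₁ U + x₁² B` -/

/-- A series all of whose monomials have degree `≥ 2` in `(x₀, x₁)` is `x₀² A + x₀ (x₁ U) + x₁² B`
with `A(0)`, `U(0)`, `B(0)` its coefficients of `x₀²`, `x₀x₁`, `x₁²`. -/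
theorem decompose {n : ℕ} (g : MvPowerSeries (Fin (n + 2)) k)
    (hg : ∀ d : Fin (n + 2) →₀ ℕ, d 0 + d 1 ≤ 1 → MvPowerSeries.coeff d g = 0) :
    ∃ A U B : MvPowerSeries (Fin (n + 2)) k,
      g = MvPowerSeries.X 0 ^ 2 * A + MvPowerSeries.X 0 * (MvPowerSeries.X 1 * U) + MvPowerSeries.X 1 ^ 2 * B ∧
      MvPowerSeries.constantCoeff A = MvPowerSeries.coeff (Finsupp.single 0 2) g ∧
      MvPowerSeries.constantCoeff U = MvPowerSeries.coeff (Finsupp.single 0 1 + Finsupp.single 1 1) g ∧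
      MvPowerSeries.constantCoeff B = MvPowerSeries.coeff (Finsupp.single 1 2) g := by
  classical
  -- the three slices of `g` by the exponent of `x₀` (`≥ 2`, `= 1`, `= 0`)
  let gA : MvPowerSeries (Fin (n + 2)) k := fun d => if 2 ≤ d 0 then MvPowerSeries.coeff d g else 0
  let gU : MvPowerSeries (Fin (n + 2)) k := fun d => if d 0 = 1 then MvPowerSeries.coeff d g else 0
  let gB : MvPowerSeries (Fin (n + 2)) k := fun d => if d 0 = 0 then MvPowerSeries.coeff d g else 0
  have hsum : g = gA + gU + gB := by
    ext d
    rw [map_add, map_add]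
    show _ = gA d + gU d + gB d
    simp only [gA, gU, gB]
    split_ifs <;> (try omega) <;> simp
  have hAd : (MvPowerSeries.X 0 : MvPowerSeries (Fin (n + 2)) k) ^ 2 ∣ gA := by
    rw [MvPowerSeries.X_pow_dvd_iff]
    intro m hm
    show gA m = 0
    simp only [gA]
    rw [if_neg (by omega)]
  obtain ⟨A, hAeq⟩ := hAd
  have hBd : (MvPowerSeries.X 1 : MvPowerSeries (Fin (n + 2)) k) ^ 2 ∣ gB := by
    rw [MvPowerSeries.X_pow_dvd_iff]
    intro m hm
    show gB m = 0
    simp only [gB]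
    split_ifs with h
    · exact hg m (by omega)
    · rfl
  obtain ⟨B, hBeq⟩ := hBd
  have hVd : (MvPowerSeries.X 0 : MvPowerSeries (Fin (n + 2)) k) ∣ gU := by
    rw [MvPowerSeries.X_dvd_iff]
    intro m hm
    show gU m = 0
    simp only [gU]
    rw [if_neg (by omega)]
  obtain ⟨V, hVeq⟩ := hVd
  have hVU : ∀ m : Fin (n + 2) →₀ ℕ, MvPowerSeries.coeff m V = gU (Finsupp.single 0 1 + m) := by
    intro m
    have h1 : MvPowerSeries.coeff (Finsupp.single 0 1 + m) gU = MvPowerSeries.coeff m V := by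
      rw [hVeq, MvPowerSeries.X_def (0 : Fin (n + 2)), MvPowerSeries.coeff_add_monomial_mul, one_mul]
    rw [← h1]
    rfl
  have hUd : (MvPowerSeries.X 1 : MvPowerSeries (Fin (n + 2)) k) ∣ V := by
    rw [MvPowerSeries.X_dvd_iff]
    intro m hm
    rw [hVU]
    simp only [gU, Finsupp.add_apply, Finsupp.single_eq_same]
    split_ifs with h
    · exact hg _ (by simp; omega)
    · rfl
  obtain ⟨U, hUeq⟩ := hUd
  refine ⟨A, U, B, ?_, ?_, ?_, ?_⟩
  · rw [← hAeq, ← hUeq, ← hVeq, ← hBeq]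
    exact hsum
  · have h1 : MvPowerSeries.coeff (Finsupp.single 0 2) gA = MvPowerSeries.constantCoeff A := by
      rw [hAeq, MvPowerSeries.X_pow_eq, MvPowerSeries.coeff_monomial_mul, if_pos le_rfl, tsub_self, one_mul,
        MvPowerSeries.coeff_zero_eq_constantCoeff_apply]
    rw [← h1]
    show gA _ = _
    simp only [gA]
    rw [if_pos (by simp)]
  · have h1 : MvPowerSeries.coeff (Finsupp.single 1 1) V = MvPowerSeries.constantCoeff U := by
      rw [hUeq, MvPowerSeries.X_def (1 : Fin (n + 2)), MvPowerSeries.coeff_monomial_mul, if_pos le_rfl, tsub_self,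
        one_mul, MvPowerSeries.coeff_zero_eq_constantCoeff_apply]
    rw [← h1, hVU]
    simp only [gU]
    rw [if_pos (by simp)]
  · have h1 : MvPowerSeries.coeff (Finsupp.single 1 2) gB = MvPowerSeries.constantCoeff B := by
      rw [hBeq, MvPowerSeries.X_pow_eq, MvPowerSeries.coeff_monomial_mul, if_pos le_rfl, tsub_self, one_mul,
        MvPowerSeries.coeff_zero_eq_constantCoeff_apply]
    rw [← h1]
    show gB _ = _
    simp only [gB]
    rw [if_pos (by simp)]

end HyperbolicSplit

open HyperbolicSplit in
/-- THE FORMAL MORSE LEMMA WITH PARAMETERS, SPLITTING STEP (any field, any characteristic): a singular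
germ `f ∈ k[[x₀, …, x_{n+1}]]` with no `x₀²`, no `x₁²` term, `∂²f/∂x₀∂x₁(0) ≠ 0` and no monomial of
degree exactly one in `(x₀, x₁)` becomes `x₀ x₁ + H(x₂, …, x_{n+1})` after a legal formal coordinate
change `θ` — decomposition `f = H + x₀² A + x₀x₁ U + x₁² B`, Hensel's lemma in `k[[x]]` for
`T² − U T + A B`, factorisation `(x₀ + λ x₁)(A x₀ + u x₁)`, and the formal inverse function theorem. -/
theorem stub_hyperbolicSplit : ∀ (k : Type) [Field k] (n : ℕ) (f : MvPowerSeries (Fin (n + 2)) k),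
    CobordantGame.IsSingular k f →
    MvPowerSeries.coeff (Finsupp.single 0 2) f = 0 → MvPowerSeries.coeff (Finsupp.single 1 2) f = 0 →
    MvPowerSeries.coeff (Finsupp.single 0 1 + Finsupp.single 1 1) f ≠ 0 →
    (∀ d : Fin (n + 2) →₀ ℕ, d 0 + d 1 = 1 → MvPowerSeries.coeff d f = 0) →
    ∃ θ : Fin (n + 2) → MvPowerSeries (Fin (n + 2)) k, (∀ i, MvPowerSeries.constantCoeff (θ i) = 0) ∧
      IsUnit (Matrix.det (Matrix.of fun i j => MvPowerSeries.coeff (Finsupp.single j 1) (θ i))) ∧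
      ∃ H : MvPowerSeries (Fin n) k, MvPowerSeries.subst θ f =
        MvPowerSeries.X (0 : Fin (n + 2)) * MvPowerSeries.X (1 : Fin (n + 2)) +
          MvPowerSeries.rename (Fin.addNatEmb 2) H := by
  intro k _ n f _hf h20 h02 h11 hlin
  classical
  set ι : Fin n ↪ Fin (n + 2) := Fin.addNatEmb 2 with hι
  set H : MvPowerSeries (Fin n) k := MvPowerSeries.killCompl ι f with hH
  set g : MvPowerSeries (Fin (n + 2)) k := f - MvPowerSeries.rename ι H with hg
  -- (1) the coefficients of `g` and the decomposition
  have hcoeff : ∀ d : Fin (n + 2) →₀ ℕ,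
      MvPowerSeries.coeff d g = if d 0 = 0 ∧ d 1 = 0 then 0 else MvPowerSeries.coeff d f := by
    intro d
    rw [hg, map_sub, hH, hι, coeff_rename_killCompl]
    split_ifs <;> simp
  have hg1 : ∀ d : Fin (n + 2) →₀ ℕ, d 0 + d 1 ≤ 1 → MvPowerSeries.coeff d g = 0 := by
    intro d hd
    rw [hcoeff]
    split_ifs with h
    · rfl
    · exact hlin d (by omega)
  obtain ⟨A, U, B, hdec, hA0, hU0, hB0⟩ := decompose g hg1
  have hA0' : MvPowerSeries.constantCoeff A = 0 := by
    rw [hA0, hcoeff, if_neg (by simp), h20]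
  have hB0' : MvPowerSeries.constantCoeff B = 0 := by
    rw [hB0, hcoeff, if_neg (by simp), h02]
  have hU0' : MvPowerSeries.constantCoeff U ≠ 0 := by
    rw [hU0, hcoeff, if_neg (by simp)]
    exact h11
  -- (2) Hensel: `u² - U u + A B = 0`, `u(0) = U(0) ≠ 0`
  obtain ⟨u, hroot, hu0⟩ := hensel_quadratic U (A * B) hU0' (by simp [hA0'])
  have hu : MvPowerSeries.constantCoeff u ≠ 0 := by
    rw [hu0]
    exact hU0'
  have hinv : u * u⁻¹ = 1 := MvPowerSeries.mul_inv_cancel u hu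
  -- (3) the factorisation `x₀² A + x₀ x₁ U + x₁² B = (x₀ + λ x₁) (A x₀ + u x₁)`, `λ = B u⁻¹`
  set lam : MvPowerSeries (Fin (n + 2)) k := B * u⁻¹ with hlam
  have hlam0 : MvPowerSeries.constantCoeff lam = 0 := by
    simp [hlam, hB0']
  have hUeq : U = u + A * B * u⁻¹ := by
    linear_combination (-u⁻¹) * hroot + (u - U) * hinv
  have hfac : (MvPowerSeries.X 0 ^ 2 * A + MvPowerSeries.X 0 * (MvPowerSeries.X 1 * U) +
      MvPowerSeries.X 1 ^ 2 * B : MvPowerSeries (Fin (n + 2)) k) =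
      (MvPowerSeries.X 0 + lam * MvPowerSeries.X 1) * (A * MvPowerSeries.X 0 + u * MvPowerSeries.X 1) := by
    rw [hUeq, hlam]
    linear_combination (-(MvPowerSeries.X 1 ^ 2 * B)) * hinv
  -- (4) the coordinate change `Ψ = (x₀ + λ x₁, A x₀ + u x₁, x₂, …)` with `f = Ψ^*(x₀ x₁ + rename ι H)`
  set Ψ : Fin (n + 2) → MvPowerSeries (Fin (n + 2)) k := fun i =>
    if i = 0 then MvPowerSeries.X 0 + lam * MvPowerSeries.X 1
    else if i = 1 then A * MvPowerSeries.X 0 + u * MvPowerSeries.X 1 else MvPowerSeries.X i with hΨ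
  have hΨ0 : Ψ 0 = MvPowerSeries.X 0 + lam * MvPowerSeries.X 1 := by
    simp [hΨ]
  have hΨ1 : Ψ 1 = A * MvPowerSeries.X 0 + u * MvPowerSeries.X 1 := by
    simp [hΨ]
  have hΨi : ∀ i : Fin (n + 2), i ≠ 0 → i ≠ 1 → Ψ i = MvPowerSeries.X i := by
    intro i h0 h1
    simp [hΨ, h0, h1]
  have hΨc : ∀ i, MvPowerSeries.constantCoeff (Ψ i) = 0 := by
    intro i
    by_cases h0 : i = 0
    · subst h0
      simp [hΨ0, MvPowerSeries.constantCoeff_X, hlam0]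
    by_cases h1 : i = 1
    · subst h1
      simp [hΨ1, MvPowerSeries.constantCoeff_X, hA0']
    · rw [hΨi i h0 h1, MvPowerSeries.constantCoeff_X]
  have hΨι : ∀ m : Fin n, Ψ (ι m) = MvPowerSeries.X (ι m) := by
    intro m
    refine hΨi _ ?_ ?_
    · simp [hι, Fin.ext_iff]
    · simp [hι, Fin.ext_iff]
  have hfΨ : MvPowerSeries.subst Ψ (MvPowerSeries.X 0 * MvPowerSeries.X 1 + MvPowerSeries.rename ι H) = f := by
    have hs := MvPowerSeries.hasSubst_of_constantCoeff_zero hΨc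
    rw [MvPowerSeries.subst_add hs, MvPowerSeries.subst_mul hs, MvPowerSeries.subst_X hs, MvPowerSeries.subst_X hs,
      subst_rename_eq ι Ψ hΨc H]
    have hren : MvPowerSeries.subst (fun m => Ψ (ι m)) H = MvPowerSeries.rename ι H := by
      rw [show (fun m => Ψ (ι m)) = MvPowerSeries.X ∘ ι from funext hΨι]
      exact (MvPowerSeries.rename_eq_subst _ H).symm
    rw [hren, hΨ0, hΨ1, ← hfac, ← hdec, hg, sub_add_cancel]
  -- its linear part is `diag(1, u(0), 1, …, 1)`
  have hlinMat : FormalCoordChange.linMat Ψ =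
      Matrix.diagonal (fun i => if i = 1 then MvPowerSeries.constantCoeff u else 1) := by
    ext i j
    rw [FormalCoordChange.linMat, Matrix.of_apply, Matrix.diagonal_apply]
    by_cases h0 : i = 0
    · subst h0
      rw [hΨ0, map_add, coeff_single_mul_X, hlam0, MvPowerSeries.coeff_index_single_X]
      rcases eq_or_ne j 0 with rfl | hj
      · simp
      · simp [hj, Ne.symm hj]
    by_cases h1 : i = 1
    · subst h1
      rw [hΨ1, map_add, coeff_single_mul_X, coeff_single_mul_X, hA0']
      rcases eq_or_ne j 1 with rfl | hj
      · simp
      · simp [hj, Ne.symm hj]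
    · rw [hΨi i h0 h1, MvPowerSeries.coeff_index_single_X, if_neg h1]
      rcases eq_or_ne j i with rfl | hj
      · simp
      · simp [hj, Ne.symm hj]
  have hΨdet : IsUnit (FormalCoordChange.linMat Ψ).det := by
    rw [hlinMat, Matrix.det_diagonal, Finset.prod_ite_eq']
    simpa using hu
  -- (5) invert `Ψ`
  obtain ⟨θ, hθ0, hθΨ, -⟩ := FormalCoordChange.exists_comp_inverse hΨc hΨdet
  refine ⟨θ, hθ0, isUnit_det_linMat_of_comp_eq_X hθ0 hθΨ, H, ?_⟩
  conv_lhs => rw [← hfΨ]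
  exact subst_subst_of_comp_eq_X hΨc hθ0 hθΨ _

end Summit.ResolutionOfSingularities.ResolutionOfSingularities.Theorems
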